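import Summits.AtomisticToContinuum.BoseEinsteinCondensation.Theorems.BECCutLineWeakDisorderWitnessTransferSpectral
import Literature.MathematicalPhysics.QuantumManyBody.GroundStateFeynmanKacCutLine
import HarnessLib

/-!
# Route BECCutLineWeakDisorder — `WitnessTransfer`, III: the `g ≡ 1` witnesses converge to the
ground state, with a uniform bound

Support file (does not close the item) for item stmt-AtomisticToContinuum-14978
(`Summit.AtomisticToContinuum.BoseEinsteinCondensation.Theses.BECCutLineWeakDisorder.WitnessTransfer`).
The route's crux `TwoReplicaTransienceBound` is typed over the finite-`T` Feynman–Kac witnesses with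
constant boundary datum, `Ψ_T = fkWitness v L T 1 = e^{-TH_N}1/‖e^{-TH_N}1‖₂`; the library's
convergence theorem `IsGroundStateFK.tendsto_fkWitness` (Simon's (A7)) asks for a datum
`0 ≤ g ≤ C Ψ₀`, which `g ≡ 1` violates (the ground state vanishes at the walls). Here the `g ≡ 1`
case is done for a bounded measurable pair potential `v` and a Feynman–Kac ground state `Ψ₀`
(`IsGroundStateFK v L Ψ₀`), using the spectral bounds of part II
(`BECCutLineWeakDisorderWitnessTransferSpectral.lean`):

* `exp_mul_fkSemigroup_one_le` — **uniform bound** `e^{E₀T}(e^{-TH_N}1)(X) ≤ K < ∞` for all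
  `T ≥ 1` and all `X` (semigroup law at time `1`, the `L² → L^∞` bound `fkSemigroup_le_L2`, and
  `‖e^{-(T-1)H_N}1‖₂² ≤ e^{-2E₀(T-1)}|Λ|`);
* `sq_exp_mul_lintegral_le_fkNormSq_one` — **lower bound** `‖e^{-TH_N}1‖₂ ≥ e^{-E₀T}⟨Ψ₀, 1⟩`
  (Cauchy–Schwarz against `Ψ₀`, symmetry and the eigen-relation);
* `tendsto_exp_mul_fkNormSq_one` — `e^{2E₀T}‖e^{-TH_N}1‖₂² → ⟨Ψ₀, 1⟩²` (dominated convergence with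
  the uniform bound);
* `tendsto_fkWitness_one` — **`Ψ_T(X) → Ψ₀(X)` for every `X`** (Simon (1982) (A7) with `f = 1`);
* `fkWitness_one_le` — **`Ψ_T(X) ≤ K_w` for all `T ≥ 1`, `X`**.

## References

* B. Simon, *Schrödinger semigroups*, Bull. AMS 7 (1982), §A1 (A5)–(A7). [Simon1982]
* K. L. Chung, Z. Zhao, *From Brownian Motion to Schrödinger's Equation* (1995), Thm 3.17,
  Thm 3.27. [ChungZhao1995]
-/

noncomputable section

open MeasureTheory Filter Set
open scoped ENNReal NNReal Topology

namespace Summit.AtomisticToContinuum.BoseEinsteinCondensation.Theorems.CutLineWitness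

open Literature.MathematicalPhysics.QuantumManyBody.BoseGas

variable {N : ℕ}


/-! ### The uniform bound -/

/-- The `L² → L^∞` constant of `fkSemigroup_le_L2` is finite. [folklore] -/
theorem l2linf_const_ne_top (t : ℝ) :
    (∏ _i : Fin N, ∏ _k : Fin 3,
        ENNReal.ofReal (Real.sqrt (2 * Real.pi * (2 * t.toNNReal)))⁻¹) ^ (1 / 2 : ℝ) ≠ ⊤ := by
  refine ENNReal.rpow_ne_top_of_nonneg (by norm_num) (ne_of_lt ?_)
  exact ENNReal.prod_lt_top fun i _ => ENNReal.prod_lt_top fun k _ => ENNReal.ofReal_lt_top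

/-- The `L² → L^∞` bound of the Feynman–Kac functional at time one, with an anonymous finite
constant. [cite: ChungZhao1995, Thm 3.17] -/
theorem exists_fkSemigroup_one_le_L2 (v : ℝ → ℝ≥0∞) (L : ℝ) :
    ∃ κ : ℝ≥0∞, κ ≠ ⊤ ∧ ∀ g : Config N → ℝ≥0∞, Measurable g → ∀ X : Config N,
      fkSemigroup v L 1 g X ≤ κ * (∫⁻ Y, g Y ^ (2 : ℝ)) ^ (1 / 2 : ℝ) :=
  ⟨_, l2linf_const_ne_top 1, fun _ hg X => fkSemigroup_le_L2 v L one_pos hg X⟩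

/-- **Uniform bound on the renormalised partition function**: for a bounded measurable pair
potential, `L > 0` and a Feynman–Kac ground state with `E₀ = groundStateEnergy v N L`, there is
`K < ∞` with `e^{E₀T} (e^{-TH_N}1)(X) ≤ K` for all `T ≥ 1` and all `X`
(`e^{-TH_N}1 = e^{-H_N}(e^{-(T-1)H_N}1)`, the `L² → L^∞` bound at time one, and
`‖e^{-(T-1)H_N}1‖₂² = ⟨1, e^{-2(T-1)H_N}1⟩ ≤ e^{-2E₀(T-1)}|Λ_L^N|`). Chung–Zhao (1995), Thm 3.17
with Thm 3.27. [cite: ChungZhao1995, Thm 3.17] -/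
theorem exp_mul_fkSemigroup_one_le {v : ℝ → ℝ≥0∞} (hv : Measurable v) {C : ℝ≥0}
    (hC : ∀ r, v r ≤ C) {L : ℝ} (hL : 0 < L) {Ψ₀ : Config N → ℝ} (h : IsGroundStateFK v L Ψ₀) :
    ∃ K : ℝ≥0∞, K ≠ ⊤ ∧ ∀ T : ℝ, 1 ≤ T → ∀ X : Config N,
      ENNReal.ofReal (Real.exp ((groundStateEnergy v N L).toReal * T)) *
        fkSemigroup v L T (fun _ => (1 : ℝ≥0∞)) X ≤ K := by
  set E : ℝ := (groundStateEnergy v N L).toReal with hE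
  obtain ⟨κ, hκt, hκ⟩ := exists_fkSemigroup_one_le_L2 (N := N) v L
  refine ⟨ENNReal.ofReal (Real.exp E) * κ * volume (boxN N L) ^ (1 / 2 : ℝ), ?_, fun T hT X => ?_⟩
  · exact ENNReal.mul_ne_top (ENNReal.mul_ne_top ENNReal.ofReal_ne_top hκt)
      (ENNReal.rpow_ne_top_of_nonneg (by norm_num) (volume_boxN_lt_top N L).ne)
  have hT1 : 0 ≤ T - 1 := by linarith
  have hmeasT : Measurable (fkSemigroup v L (T - 1) fun _ : Config N => (1 : ℝ≥0∞)) :=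
    measurable_fkSemigroup hv L (T - 1) measurable_const
  -- split at time one and apply the `L² → L^∞` bound
  have hsplit : fkSemigroup v L T (fun _ => (1 : ℝ≥0∞)) X =
      fkSemigroup v L 1 (fkSemigroup v L (T - 1) fun _ => (1 : ℝ≥0∞)) X := by
    have := fkSemigroup_add hv L zero_le_one hT1
      (measurable_const : Measurable fun _ : Config N => (1 : ℝ≥0∞)) X
    rwa [add_sub_cancel] at this
  have hL2 : fkSemigroup v L 1 (fkSemigroup v L (T - 1) fun _ => (1 : ℝ≥0∞)) X ≤
      κ * (∫⁻ Y : Config N, fkSemigroup v L (T - 1) (fun _ => (1 : ℝ≥0∞)) Y ^ (2 : ℝ)) ^ (1 / 2 : ℝ) :=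
    hκ _ hmeasT X
  -- `‖e^{-(T-1)H}1‖₂² ≤ e^{-2E₀(T-1)} |Λ|`
  have hsq : ∫⁻ Y : Config N, fkSemigroup v L (T - 1) (fun _ => (1 : ℝ≥0∞)) Y ^ (2 : ℝ) ≤
      ENNReal.ofReal (Real.exp (-(E * (2 * (T - 1))))) * volume (boxN N L) := by
    calc ∫⁻ Y : Config N, fkSemigroup v L (T - 1) (fun _ => (1 : ℝ≥0∞)) Y ^ (2 : ℝ)
        = fkNormSq (N := N) v L (T - 1) (fun _ => (1 : ℝ≥0∞)) := by
          rw [fkNormSq]; exact lintegral_congr fun Y => ENNReal.rpow_two _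
      _ = ∫⁻ Y : Config N, fkSemigroup v L (2 * (T - 1)) (fun _ => (1 : ℝ≥0∞)) Y := by
          rw [fkNormSq_eq hv L hT1 measurable_const]
          exact lintegral_congr fun Y => one_mul _
      _ ≤ _ := lintegral_fkSemigroup_one_le_exp hv hC hL h (by linarith)
  -- the exponentials combine
  have hexp : ENNReal.ofReal (Real.exp (E * T)) *
      (ENNReal.ofReal (Real.exp (-(E * (2 * (T - 1)))))) ^ (1 / 2 : ℝ) =
      ENNReal.ofReal (Real.exp E) := by
    rw [ENNReal.ofReal_rpow_of_nonneg (Real.exp_pos _).le (by norm_num), ← Real.exp_mul,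
      ← ENNReal.ofReal_mul (Real.exp_pos _).le, ← Real.exp_add]
    congr 1; ring_nf
  have h12 : (0 : ℝ) ≤ 1 / 2 := by norm_num
  calc ENNReal.ofReal (Real.exp (E * T)) * fkSemigroup v L T (fun _ => (1 : ℝ≥0∞)) X
      ≤ ENNReal.ofReal (Real.exp (E * T)) * (κ * (ENNReal.ofReal (Real.exp (-(E * (2 * (T - 1))))) *
          volume (boxN N L)) ^ (1 / 2 : ℝ)) := by
        rw [hsplit]
        exact mul_le_mul' le_rfl (hL2.trans (mul_le_mul' le_rfl (ENNReal.rpow_le_rpow hsq h12)))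
    _ = ENNReal.ofReal (Real.exp (E * T)) *
          (ENNReal.ofReal (Real.exp (-(E * (2 * (T - 1)))))) ^ (1 / 2 : ℝ) * κ *
            volume (boxN N L) ^ (1 / 2 : ℝ) := by
        rw [ENNReal.mul_rpow_of_nonneg _ _ h12]; ring_nf
    _ = ENNReal.ofReal (Real.exp E) * κ * volume (boxN N L) ^ (1 / 2 : ℝ) := by rw [hexp]

/-! ### The lower bound on the norm -/

/-- The overlap `⟨Ψ₀, 1⟩ = ∫ Ψ₀` of a Feynman–Kac ground state is positive and finite. [folklore] -/
theorem lintegral_groundState_pos_ne_top {v : ℝ → ℝ≥0∞} {L : ℝ} {Ψ₀ : Config N → ℝ}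
    (h : IsGroundStateFK v L Ψ₀) :
    (∫⁻ Y, ENNReal.ofReal (Ψ₀ Y)) ≠ 0 ∧ (∫⁻ Y, ENNReal.ofReal (Ψ₀ Y)) ≠ ⊤ := by
  constructor
  · intro h0
    have hae : (fun Y => ENNReal.ofReal (Ψ₀ Y)) =ᵐ[volume] 0 :=
      (lintegral_eq_zero_iff h.measurable.ennreal_ofReal).1 h0
    have h1 : ∫⁻ Y, ENNReal.ofReal (Ψ₀ Y) ^ 2 = 0 := by
      rw [lintegral_eq_zero_iff (h.measurable.ennreal_ofReal.pow_const 2)]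
      filter_upwards [hae] with Y hY
      simp [hY]
    rw [h.norm_eq] at h1
    exact one_ne_zero h1
  · have hg1m : Measurable ((boxN N L).indicator fun _ : Config N => (1 : ℝ≥0∞)) :=
      measurable_const.indicator (measurableSet_boxN N L)
    have hg12 : ∫⁻ Y, ((boxN N L).indicator (fun _ : Config N => (1 : ℝ≥0∞)) Y) ^ 2 ≠ ⊤ := by
      rw [show (fun Y => ((boxN N L).indicator (fun _ : Config N => (1 : ℝ≥0∞)) Y) ^ 2) =
          (boxN N L).indicator (fun _ : Config N => (1 : ℝ≥0∞)) from funext fun Y => by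
            by_cases hY : Y ∈ boxN N L <;> simp [hY],
        lintegral_indicator (measurableSet_boxN N L), setLIntegral_one]
      exact (volume_boxN_lt_top N L).ne
    have hA := lintegral_groundState_mul_ne_top h hg1m hg12
    have heq : ∫⁻ Y, ENNReal.ofReal (Ψ₀ Y) * (boxN N L).indicator (fun _ : Config N => (1 : ℝ≥0∞)) Y =
        ∫⁻ Y, ENNReal.ofReal (Ψ₀ Y) := by
      refine lintegral_congr fun Y => ?_
      by_cases hY : Y ∈ boxN N L
      · simp [hY]
      · simp [hY, h.eq_zero Y hY]
    rwa [heq] at hA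

/-- **`e^{-E₀T}⟨Ψ₀, 1⟩ ≤ ‖e^{-TH_N}1‖₂`**, squared, for `T ≥ 0`: Cauchy–Schwarz against the
normalised `Ψ₀`, then symmetry of the functional and the eigen-relation,
`⟨Ψ₀, e^{-TH_N}1⟩ = ⟨e^{-TH_N}Ψ₀, 1⟩ = e^{-E₀T}⟨Ψ₀, 1⟩`. [cite: Simon1982, §A1 (A7) p. 449] -/
theorem sq_exp_mul_lintegral_le_fkNormSq_one {v : ℝ → ℝ≥0∞} (hv : Measurable v) {L : ℝ}
    {Ψ₀ : Config N → ℝ} (h : IsGroundStateFK v L Ψ₀) {T : ℝ} (hT : 0 ≤ T) :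
    (ENNReal.ofReal (Real.exp (-((groundStateEnergy v N L).toReal * T))) *
        ∫⁻ Y, ENNReal.ofReal (Ψ₀ Y)) ^ 2 ≤ fkNormSq (N := N) v L T (fun _ => (1 : ℝ≥0∞)) := by
  have hΨm : Measurable fun Y => ENNReal.ofReal (Ψ₀ Y) := h.measurable.ennreal_ofReal
  have hSm : Measurable (fkSemigroup v L T fun _ : Config N => (1 : ℝ≥0∞)) :=
    measurable_fkSemigroup hv L T measurable_const
  -- `⟨Ψ₀, e^{-TH}1⟩ = e^{-E₀T} ∫ Ψ₀`
  have hA : ∫⁻ X, ENNReal.ofReal (Ψ₀ X) * fkSemigroup v L T (fun _ => (1 : ℝ≥0∞)) X =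
      ENNReal.ofReal (Real.exp (-((groundStateEnergy v N L).toReal * T))) *
        ∫⁻ Y, ENNReal.ofReal (Ψ₀ Y) := by
    rw [lintegral_mul_fkSemigroup_comm hv L hT hΨm measurable_const,
      ← lintegral_const_mul' _ _ ENNReal.ofReal_ne_top]
    refine lintegral_congr fun X => ?_
    rw [one_mul, h.eigen T hT X, ENNReal.ofReal_mul (Real.exp_pos _).le]
  have hcs := ENNReal.lintegral_mul_le_Lp_mul_Lq volume Real.HolderConjugate.two_two
    hΨm.aemeasurable hSm.aemeasurable
  have hone : (∫⁻ Y, ENNReal.ofReal (Ψ₀ Y) ^ (2 : ℝ)) = 1 := by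
    rw [← h.norm_eq]; exact lintegral_congr fun Y => ENNReal.rpow_two _
  calc (ENNReal.ofReal (Real.exp (-((groundStateEnergy v N L).toReal * T))) *
        ∫⁻ Y, ENNReal.ofReal (Ψ₀ Y)) ^ 2
      = (∫⁻ X, ENNReal.ofReal (Ψ₀ X) * fkSemigroup v L T (fun _ => (1 : ℝ≥0∞)) X) ^ 2 := by rw [hA]
    _ ≤ ((∫⁻ Y, ENNReal.ofReal (Ψ₀ Y) ^ (2 : ℝ)) ^ (1 / 2 : ℝ) *
          (∫⁻ Y : Config N, fkSemigroup v L T (fun _ => (1 : ℝ≥0∞)) Y ^ (2 : ℝ)) ^ (1 / 2 : ℝ)) ^ 2 :=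
        pow_le_pow_left' hcs 2
    _ = ∫⁻ Y : Config N, fkSemigroup v L T (fun _ => (1 : ℝ≥0∞)) Y ^ (2 : ℝ) := by
        rw [hone, ENNReal.one_rpow, one_mul, ← ENNReal.rpow_two, ← ENNReal.rpow_mul]
        norm_num
    _ = fkNormSq (N := N) v L T (fun _ => (1 : ℝ≥0∞)) := by
        rw [fkNormSq]; exact lintegral_congr fun Y => ENNReal.rpow_two _

/-- `‖e^{-TH_N}1‖₂² ≤ |Λ_L^N|` (`T ≥ 0`): the functional of `1` is at most `𝟙_Λ`. [folklore] -/
theorem fkNormSq_one_le (v : ℝ → ℝ≥0∞) {L T : ℝ} (hT : 0 ≤ T) :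
    fkNormSq (N := N) v L T (fun _ => (1 : ℝ≥0∞)) ≤ volume (boxN N L) := by
  rw [fkNormSq, ← setLIntegral_one, ← lintegral_indicator (measurableSet_boxN N L)]
  refine lintegral_mono fun X => ?_
  by_cases hX : X ∈ boxN N L
  · rw [Set.indicator_of_mem hX]
    calc fkSemigroup v L T (fun _ => (1 : ℝ≥0∞)) X ^ 2 ≤ 1 ^ 2 :=
          pow_le_pow_left' (fkPartition_le_one v L T X) 2
      _ = 1 := one_pow 2
  · rw [Set.indicator_of_notMem hX, fkSemigroup_of_notMem v hT _ hX]
    simp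

/-! ### Convergence -/

/-- The renormalised partition function converges pointwise to `⟨Ψ₀, 1⟩ Ψ₀`:
`e^{E₀T}(e^{-TH_N}1)(X) → (∫Ψ₀) Ψ₀(X)` (the ground-state projection of `IsGroundStateFK` for the
observable `𝟙_Λ`). [cite: Simon1982, §A1 (A6)–(A7) p. 449] -/
theorem tendsto_exp_mul_fkSemigroup_one {v : ℝ → ℝ≥0∞} {L : ℝ} {Ψ₀ : Config N → ℝ}
    (h : IsGroundStateFK v L Ψ₀) (X : Config N) :
    Tendsto (fun T : ℝ => ENNReal.ofReal (Real.exp ((groundStateEnergy v N L).toReal * T)) *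
      fkSemigroup v L T (fun _ => (1 : ℝ≥0∞)) X) atTop
      (𝓝 ((∫⁻ Y, ENNReal.ofReal (Ψ₀ Y)) * ENNReal.ofReal (Ψ₀ X))) := by
  have hg1m : Measurable ((boxN N L).indicator fun _ : Config N => (1 : ℝ≥0∞)) :=
    measurable_const.indicator (measurableSet_boxN N L)
  have hg12 : ∫⁻ Y, ((boxN N L).indicator (fun _ : Config N => (1 : ℝ≥0∞)) Y) ^ 2 ≠ ⊤ := by
    rw [show (fun Y => ((boxN N L).indicator (fun _ : Config N => (1 : ℝ≥0∞)) Y) ^ 2) =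
        (boxN N L).indicator (fun _ : Config N => (1 : ℝ≥0∞)) from funext fun Y => by
          by_cases hY : Y ∈ boxN N L <;> simp [hY],
      lintegral_indicator (measurableSet_boxN N L), setLIntegral_one]
    exact (volume_boxN_lt_top N L).ne
  have heq : ∫⁻ Y, ENNReal.ofReal (Ψ₀ Y) * (boxN N L).indicator (fun _ : Config N => (1 : ℝ≥0∞)) Y =
      ∫⁻ Y, ENNReal.ofReal (Ψ₀ Y) := by
    refine lintegral_congr fun Y => ?_
    by_cases hY : Y ∈ boxN N L
    · simp [hY]
    · simp [hY, h.eq_zero Y hY]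
  have ht := h.tendsto _ hg1m hg12 X
  rw [heq] at ht
  refine ht.congr' ?_
  filter_upwards [eventually_ge_atTop 0] with T hT
  rw [fkSemigroup_indicator v L hT]

/-- **`e^{2E₀T} ‖e^{-TH_N}1‖₂² → ⟨Ψ₀, 1⟩²`** as `T → ∞`, for a bounded measurable pair potential and
a Feynman–Kac ground state: dominated convergence of `∫ (e^{E₀T} e^{-TH_N}1)²` with the uniform
bound `exp_mul_fkSemigroup_one_le`. [cite: Simon1982, §A1 (A6)–(A7) p. 449] -/
theorem tendsto_exp_mul_fkNormSq_one {v : ℝ → ℝ≥0∞} (hv : Measurable v) {C : ℝ≥0}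
    (hC : ∀ r, v r ≤ C) {L : ℝ} (hL : 0 < L) {Ψ₀ : Config N → ℝ} (h : IsGroundStateFK v L Ψ₀) :
    Tendsto (fun T : ℝ => ENNReal.ofReal (Real.exp ((groundStateEnergy v N L).toReal * (2 * T))) *
      fkNormSq (N := N) v L T (fun _ => (1 : ℝ≥0∞))) atTop (𝓝 ((∫⁻ Y, ENNReal.ofReal (Ψ₀ Y)) ^ 2)) := by
  obtain ⟨K, hKt, hK⟩ := exp_mul_fkSemigroup_one_le hv hC hL h
  set E : ℝ := (groundStateEnergy v N L).toReal with hE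
  set A : ℝ≥0∞ := ∫⁻ Y, ENNReal.ofReal (Ψ₀ Y) with hAdef
  set u : ℝ → Config N → ℝ≥0∞ := fun T X =>
    ENNReal.ofReal (Real.exp (E * T)) * fkSemigroup v L T (fun _ => (1 : ℝ≥0∞)) X with hu
  have hum : ∀ T, Measurable (u T) := fun T =>
    (measurable_fkSemigroup hv L T measurable_const).const_mul _
  have hrepr : (fun T : ℝ => ENNReal.ofReal (Real.exp (E * (2 * T))) *
      fkNormSq (N := N) v L T (fun _ => (1 : ℝ≥0∞))) = fun T => ∫⁻ X, u T X ^ 2 := by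
    funext T
    rw [fkNormSq, ← lintegral_const_mul' _ _ ENNReal.ofReal_ne_top]
    refine lintegral_congr fun X => ?_
    rw [hu, mul_pow, ← ENNReal.ofReal_pow (Real.exp_pos _).le, ← Real.exp_nat_mul]
    congr 2; push_cast; ring_nf
  have hval : ∫⁻ X, (A * ENNReal.ofReal (Ψ₀ X)) ^ 2 = A ^ 2 := by
    simp_rw [mul_pow]
    rw [lintegral_const_mul _ (h.measurable.ennreal_ofReal.pow_const 2), h.norm_eq, mul_one]
  rw [hrepr, ← hval]
  refine tendsto_lintegral_filter_of_dominated_convergence ((boxN N L).indicator fun _ => K ^ 2)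
    (Eventually.of_forall fun T => (hum T).pow_const 2) ?_ ?_ ?_
  · filter_upwards [eventually_ge_atTop 1] with T hT
    refine Eventually.of_forall fun X => ?_
    by_cases hX : X ∈ boxN N L
    · rw [Set.indicator_of_mem hX]; exact pow_le_pow_left' (hK T hT X) 2
    · rw [Set.indicator_of_notMem hX, hu]
      simp [fkSemigroup_of_notMem v (zero_le_one.trans hT) _ hX]
  · rw [lintegral_indicator (measurableSet_boxN N L), setLIntegral_const]
    exact ENNReal.mul_ne_top (ENNReal.pow_ne_top hKt) (volume_boxN_lt_top N L).ne
  · exact Eventually.of_forall fun X => ENNReal.Tendsto.pow (tendsto_exp_mul_fkSemigroup_one h X)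

/-- **The finite-`T` witnesses with constant datum converge to the ground state**:
`fkWitness v L T 1 X = (e^{-TH_N}1)(X)/‖e^{-TH_N}1‖₂ → Ψ₀(X)` for every `X`, for a bounded
measurable pair potential, `L > 0`, and `Ψ₀` the Feynman–Kac ground state — Simon's
`ψ = lim e^{-tH}f/(f, e^{-2tH}f)^{1/2}` with `f = 1` (numerator by the ground-state projection,
denominator by `tendsto_exp_mul_fkNormSq_one`; the factors `e^{E₀T}` cancel).
[cite: Simon1982, §A1 (A7) p. 449] -/
theorem tendsto_fkWitness_one {v : ℝ → ℝ≥0∞} (hv : Measurable v) {C : ℝ≥0}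
    (hC : ∀ r, v r ≤ C) {L : ℝ} (hL : 0 < L) {Ψ₀ : Config N → ℝ} (h : IsGroundStateFK v L Ψ₀)
    (X : Config N) :
    Tendsto (fun T : ℝ => fkWitness v L T (fun _ => (1 : ℝ≥0∞)) X) atTop (𝓝 (Ψ₀ X)) := by
  set A : ℝ≥0∞ := ∫⁻ Y, ENNReal.ofReal (Ψ₀ Y) with hAdef
  obtain ⟨hA0, hAt⟩ := lintegral_groundState_pos_ne_top h
  have hnum : Tendsto (fun T : ℝ =>
      (ENNReal.ofReal (Real.exp ((groundStateEnergy v N L).toReal * T)) *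
        fkSemigroup v L T (fun _ => (1 : ℝ≥0∞)) X).toReal) atTop
      (𝓝 ((A * ENNReal.ofReal (Ψ₀ X)).toReal)) :=
    (ENNReal.tendsto_toReal (ENNReal.mul_ne_top hAt ENNReal.ofReal_ne_top)).comp
      (tendsto_exp_mul_fkSemigroup_one h X)
  have hden : Tendsto (fun T : ℝ => Real.sqrt
      ((ENNReal.ofReal (Real.exp ((groundStateEnergy v N L).toReal * (2 * T))) *
        fkNormSq (N := N) v L T (fun _ => (1 : ℝ≥0∞))).toReal)) atTop (𝓝 (Real.sqrt ((A ^ 2).toReal))) :=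
    ((ENNReal.tendsto_toReal (ENNReal.pow_ne_top hAt)).comp
      (tendsto_exp_mul_fkNormSq_one hv hC hL h)).sqrt
  have hAR : A.toReal ≠ 0 := ENNReal.toReal_ne_zero.2 ⟨hA0, hAt⟩
  have hval : (A * ENNReal.ofReal (Ψ₀ X)).toReal / Real.sqrt ((A ^ 2).toReal) = Ψ₀ X := by
    rw [ENNReal.toReal_mul, ENNReal.toReal_ofReal (h.nonneg X), ENNReal.toReal_pow,
      Real.sqrt_sq ENNReal.toReal_nonneg, mul_div_cancel_left₀ _ hAR]
  have hdenne : Real.sqrt ((A ^ 2).toReal) ≠ 0 := by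
    rw [ENNReal.toReal_pow, Real.sqrt_sq ENNReal.toReal_nonneg]; exact hAR
  have heq : ∀ T : ℝ, (ENNReal.ofReal (Real.exp ((groundStateEnergy v N L).toReal * T)) *
        fkSemigroup v L T (fun _ => (1 : ℝ≥0∞)) X).toReal /
      Real.sqrt ((ENNReal.ofReal (Real.exp ((groundStateEnergy v N L).toReal * (2 * T))) *
        fkNormSq (N := N) v L T (fun _ => (1 : ℝ≥0∞))).toReal) = fkWitness v L T (fun _ => (1 : ℝ≥0∞)) X := by
    intro T
    have he : 0 < Real.exp ((groundStateEnergy v N L).toReal * T) := Real.exp_pos _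
    have he2 : Real.exp ((groundStateEnergy v N L).toReal * (2 * T)) =
        Real.exp ((groundStateEnergy v N L).toReal * T) ^ 2 := by
      rw [sq, ← Real.exp_add]; ring_nf
    rw [fkWitness_apply, ENNReal.toReal_mul, ENNReal.toReal_mul, ENNReal.toReal_ofReal he.le,
      he2, ENNReal.toReal_ofReal (sq_nonneg _), Real.sqrt_mul (sq_nonneg _), Real.sqrt_sq he.le,
      mul_div_mul_left _ _ he.ne']
  rw [← hval]
  exact (hnum.div hden hdenne).congr heq

/-- **Uniform bound on the finite-`T` witnesses**: `fkWitness v L T 1 X ≤ K_w` for all `T ≥ 1`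
and all `X` (numerator `≤ K e^{-E₀T}` by `exp_mul_fkSemigroup_one_le`, denominator
`≥ e^{-E₀T}⟨Ψ₀, 1⟩` by `sq_exp_mul_lintegral_le_fkNormSq_one`). [folklore] -/
theorem fkWitness_one_le {v : ℝ → ℝ≥0∞} (hv : Measurable v) {C : ℝ≥0}
    (hC : ∀ r, v r ≤ C) {L : ℝ} (hL : 0 < L) {Ψ₀ : Config N → ℝ} (h : IsGroundStateFK v L Ψ₀) :
    ∃ Kw : ℝ, ∀ T : ℝ, 1 ≤ T → ∀ X : Config N, fkWitness v L T (fun _ => (1 : ℝ≥0∞)) X ≤ Kw := by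
  obtain ⟨K, hKt, hK⟩ := exp_mul_fkSemigroup_one_le hv hC hL h
  set A : ℝ≥0∞ := ∫⁻ Y, ENNReal.ofReal (Ψ₀ Y) with hAdef
  obtain ⟨hA0, hAt⟩ := lintegral_groundState_pos_ne_top h
  have hApos : 0 < A.toReal := ENNReal.toReal_pos hA0 hAt
  refine ⟨K.toReal / A.toReal, fun T hT X => ?_⟩
  set E : ℝ := (groundStateEnergy v N L).toReal with hE
  set q : ℝ := Real.exp (-(E * T)) with hq
  have hq0 : 0 < q := Real.exp_pos _
  have hT0 : 0 ≤ T := zero_le_one.trans hT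
  -- numerator
  have hF : fkSemigroup v L T (fun _ => (1 : ℝ≥0∞)) X ≤ ENNReal.ofReal q * K := by
    have h1 : ENNReal.ofReal q * ENNReal.ofReal (Real.exp (E * T)) = 1 := by
      rw [← ENNReal.ofReal_mul hq0.le, hq, ← Real.exp_add, neg_add_cancel, Real.exp_zero,
        ENNReal.ofReal_one]
    calc fkSemigroup v L T (fun _ => (1 : ℝ≥0∞)) X
        = ENNReal.ofReal q * (ENNReal.ofReal (Real.exp (E * T)) *
            fkSemigroup v L T (fun _ => (1 : ℝ≥0∞)) X) := by rw [← mul_assoc, h1, one_mul]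
      _ ≤ ENNReal.ofReal q * K := mul_le_mul' le_rfl (hK T hT X)
  have hnum : (fkSemigroup v L T (fun _ => (1 : ℝ≥0∞)) X).toReal ≤ q * K.toReal := by
    have := ENNReal.toReal_mono (ENNReal.mul_ne_top ENNReal.ofReal_ne_top hKt) hF
    rwa [ENNReal.toReal_mul, ENNReal.toReal_ofReal hq0.le] at this
  -- denominator
  have hden : q * A.toReal ≤ Real.sqrt (fkNormSq (N := N) v L T (fun _ => (1 : ℝ≥0∞))).toReal := by
    have h1 := sq_exp_mul_lintegral_le_fkNormSq_one hv h hT0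
    have h2 := ENNReal.toReal_mono
      (ne_top_of_le_ne_top (volume_boxN_lt_top N L).ne (fkNormSq_one_le v hT0)) h1
    rw [ENNReal.toReal_pow, ENNReal.toReal_mul, ENNReal.toReal_ofReal hq0.le] at h2
    calc q * A.toReal = Real.sqrt ((q * A.toReal) ^ 2) := (Real.sqrt_sq (by positivity)).symm
      _ ≤ _ := Real.sqrt_le_sqrt h2
  rw [fkWitness_apply]
  calc (fkSemigroup v L T (fun _ => (1 : ℝ≥0∞)) X).toReal /
        Real.sqrt (fkNormSq (N := N) v L T (fun _ => (1 : ℝ≥0∞))).toReal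
      ≤ (q * K.toReal) / (q * A.toReal) := div_le_div₀ (by positivity) hnum (by positivity) hden
    _ = K.toReal / A.toReal := mul_div_mul_left _ _ hq0.ne'

end Summit.AtomisticToContinuum.BoseEinsteinCondensation.Theorems.CutLineWitness

end
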